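import Literature.MathematicalPhysics.QuantumFieldTheory.Balaban1983to89.Node00.StepWeightsAtNoExpansion
import Literature.MathematicalPhysics.QuantumFieldTheory.Balaban1983to89.Node00.TkNoExpansionStepZero
import Literature.MathematicalPhysics.QuantumFieldTheory.Balaban1983to89.Node00.CubeRoughSection

/-!
# NODE 00 — THE FIRST 𝐓-STEP ON AN ARBITRARY NEW SEQUENCE: 11a's `𝐓_1(s′)` VANISHES (a.e.) wherever its generation-0 weight `ζ_0(Ω₁(s′)ᶜ)`
# dies on the RESTRICTED averaging fibre; the χ₁-cubes of the label `(P₁, Q₁)` lie in the integration region `Ω₁ᶜ`; def-T's `(∅, ∅)` label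
# charges only globally small fine fields; the `U`-sections of def-T's step weights are measurable; every χ-cube carries a BOXED central coarse plaquette

Cell `pub-ymgap`, YM-PLAN Track A (HUMAN RULING D-0062), seat `pub-ymgap-dag-n11-d` (g6; R134 fan-out seat N11 [B14], strategy s2), serving K1⁗
`StabilityBAtRecordR13Sep` = stmt-QuantumFields-20290.  [III] = [Balaban1988Convergent], [B7] = [Balaban1985Averaging].  Sequel of this seat's
`Node00.TkNoExpansionStepZero` (g3: `𝐓_1(s′)` at `Ω₁(s′) = ∅` unfolded) and `Node00.StepWeightsAtNoExpansion` (g5: the two extreme labels of the first step).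

WHY THIS FILE.  The kernel half of the desk's Q-W (lit-balaban ME #15: at the 12a∕def-T junction the 𝐓-image carries p. 256's regularity cut `χreg_0`, the
step weights of record do not) was settled by this seat at the ALL-LARGE-FIELD new sequence `s′₀` only, where it needs the branch of def-R's (2.12) solution map at
rough data — decidable in the tree only for a regularity threshold `εreg` in [B7] Prop. 2's range (`…SmallRegFirstStepFails`).  This file supplies the θ-free
structure for the argument over ALL new sequences `s′` of length `1` at once, which needs NO branch of `UminOfRecord` and NO hypothesis on `εreg`:
* §1 (generic measure theory, AC-free) **`kernelTransport_ae_forall_eq_zero_of_fibre`** — for `μ`-a.e. coarse point `y`, EVERY integrand vanishing on the fibre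
  `avg⁻¹{y}` has kernel transport `0` at `y` (where the marginal density is positive the conditional law lives on the fibre: `condLaw_fibre_ae` through
  `withDensity_rnDeriv_le`; no absolute continuity of `avg_* ν` needed); `kernelRT_ae_forall_eq_zero_of_fibre` (11a's restricted kernel transport).
* §2 (11a at `n = 1`, ANY `s′`, any weights `W`, any operand) **`TkOfRecord_one_ae_zero_of_zeta_fibre`** — if for the coarse fields `V₁` of a class `Ro` the
  generation-0 weight `W.ζ 0 (Ω₁(s′))ᶜ` vanishes at every two-scale configuration `(1 updated by y on the V-bonds, V₁)` whose RESTRICTED average of record is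
  `V₁` on the image bonds, then `(𝐓_1(s′)Φ)(V₁) = 0` for `dV₁`-a.e. `V₁ ∈ Ro` (every `{S_j}`-branch is one restricted kernel transport of `ζ·(A-factor)`;
  the restriction `V₁ ↦ V₁|_{sV′}` pushes `dV₁` to product Haar); at 12a's weights (`tkWeightsOfRecord`: `ζ_0(Y) = ζ0_0(Y)·χreg_0(Y)`)
  **`TkOfRecord_one_ae_zero_of_not_regular_fibre`** — it suffices that no such configuration is `cR·ε₀`-regular on the plaquettes touching `Y = Ω₁(s′)ᶜ`.
  (V-bonds of generation `0` = the fine bonds in `Ω₁(s′)ᶜ`, image bonds = the level-1 bonds there — 11a's `genDataOfRecord … 0`, branch-independent.)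
* §3 (def-T's index map (3.5), any `k`) **`cubeχ_subset_compl_OmegaOfLabel_of_mem_fst ∕ _of_mem_snd`** — every χ_{k+1}-cube of `P_{k+1}` and of `Q_{k+1}`
  lies in `Ω_{k+1}(t)ᶜ` (`X ⊆ X̃`, `B^{k+1}(P¹)ᶜ ⊇ P̃`, (3.5) removes two layers around `Q̃ ∪ (Bᶜ)^∼`): the integration region of the new generation CONTAINS the
  cubes the label declares large.
* §4 (def-T's weights at the first step) `chiFactor_eq_zero_or_one`; **`forall_chiFactor_eq_one_of_aWeight_empty_ne_zero`**, **`forall_smallApproxFluct_of_bWeight_empty_ne_zero`**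
  (the label `(P₁, Q₁) = (∅, ∅)` is charged at `(U, V₁)` only if EVERY χ₁-cube is (3.2)-small at `V₁` and (3.3)-small at `(U, V₁)`), and then
  **`plaqSmall_of_forall_chiFactor_eq_one_of_forall_smallApproxFluct`** — `U` is `(ε₁η₁² + 4·(2δ₀))`-plaquette-small on the WHOLE torus (g5's per-cube lemma, either
  (2.12) branch, over the cube cover `B15Claim189CubePin.plaq_mem_plaqInside_cubeEnl_src`); **`measurable_wOfRecord_section`** — the `U`-sections of the resummed
  step weights are measurable for every `s′` once the residual `ζ`'s are (displayed; K0b's `zeta316OfRecord` qualifies: `measurable_zeta316OfRecord_section`).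
* §5 (torus geometry) **THE CENTRAL COARSE SITE OF A CUBE** `blockOf (π(S·a + ⌊S/2⌋·𝟙))` (the block label of the cube's centre): for a cube side `S` with
  `2·(ρ + L + 1) ≤ S` its fine image, the fine images of its unit translates, and the whole `ℓ^∞`-ball of label-radius `ρ` around its fine image lie INSIDE the
  cube `cubeEnl P S a 0` (`mem_cubeEnl_of_near_emb_centralSite`, `emb_centralSite_mem`, `emb_shift_centralSite_mem`, `emb_shift_shift_centralSite_mem`); hence
  every level-1 plaquette based there has its four bonds in `bondsIn 1 □` (`mem_bondsIn_of_corner_centralSite`) — the box of [B7] Prop. 1's locality fits in `□`.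

HONEST SCOPE.  Kernel bookkeeping on the tree's own objects (11a, 12a, def-T, def-R's cube families); nothing of Bałaban's asserted (no estimate, no branch of
(2.12) decided, [B7] Prop. 1∕2 not used here).  N11 ∕ K1⁗ NOT discharged; counts unmoved (typed 28∕28 · discharged 5∕28).  One finite four-torus at fixed
`ε = L^{−K}`; NOT ℝ⁴ ∕ OS ∕ mass gap ∕ Clay.  Sources: [III] (2.18) p.257, (2.20)–(2.22) p.258, (2.10) p.256, (2.16)–(2.17) p.257, (3.1)–(3.5) pp.264–265,
(3.16) p.268, (3.20)–(3.21) p.269, (3.24)–(3.25) p.270; [B7] (9)–(10) p.19; [Balaban1987RG1] (0.1)–(0.3) pp.251–252.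
-/

noncomputable section

open MeasureTheory
open scoped Matrix.Norms.L2Operator BigOperators NNReal ENNReal

namespace Literature.MathematicalPhysics.QuantumFieldTheory.Balaban1983to89.Node00

open T4AveragingDisintegration T4Continuum T4FiniteEpsInhabited Tk B14.Eq218Concrete
open B15DeterminingSets B14.Eq213DetSet B14.Eq216Concrete B14.Eq213MaximalDomains B15Eq112TorusCover B14DomainGeom B14.Sect3Decomp
open B14SeparationOfRecord (mem_hullD_iff mem_fillD_iff)
open B15Claim189CubePin (cubeOfSite cubeOfSite_mem_cubeIndices mem_cubeEnl_cubeOfSite plaq_mem_plaqInside_cubeEnl_src cover_add_single)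
open B10Eq42TorusConstraint (bondsIn mem_bondsIn_iff)
open GaugeField (plaqHol)

/-! ## §1  Generic: an integrand vanishing on the averaging fibre has zero kernel transport, a.e. in the coarse variable (AC-free) -/

section FibreVanish

variable {α β : Type*} [MeasurableSpace α] [MeasurableSpace β] [StandardBorelSpace β] [Nonempty β]

/-- **AC-FREE FIBRE VANISHING**: for `μ`-almost every coarse point `y`, EVERY integrand that vanishes on the fibre `{U | avg U = y}` has kernel transport `0` at
`y`.  Where the marginal density `d(avg_*ν)/dμ` vanishes the transport is `0`; on its support the conditional law gives full mass to the fibre (`condLaw_fibre_ae`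
is `avg_*ν`-a.e., and `μ.withDensity (d(avg_*ν)/dμ) ≤ avg_*ν` transfers the null set).  No absolute continuity of `avg_*ν`, no integrability — the kernel form of
the constraint `δ(ŪV⁻¹)` of the renormalization transformation. [cite: Balaban1985Averaging, (10) p.19 (bookkeeping); Balaban1988Convergent, (2.21) p.258] -/
theorem kernelTransport_ae_forall_eq_zero_of_fibre (ν : Measure β) [IsFiniteMeasure ν] (μ : Measure α) [SigmaFinite μ] {avg : β → α}
    (havg : Measurable avg) [MeasurableEq α] :
    ∀ᵐ y ∂μ, ∀ f : β → ℝ, (∀ U, avg U = y → f U = 0) → kernelTransport ν μ avg f y = 0 := by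
  have hfib := condLaw_fibre_ae ν havg
  have hle : μ.withDensity ((ν.map avg).rnDeriv μ) ≤ ν.map avg := Measure.withDensity_rnDeriv_le _ _
  have h1 : ∀ᵐ y ∂μ.withDensity ((ν.map avg).rnDeriv μ), condLaw ν avg y {U | avg U = y} = 1 :=
    (Measure.absolutelyContinuous_of_le hle).ae_le hfib
  rw [ae_withDensity_iff (Measure.measurable_rnDeriv _ _)] at h1
  filter_upwards [h1] with y hy f hf
  unfold kernelTransport
  by_cases h0 : margDensity ν μ avg y = 0
  · rw [h0, NNReal.coe_zero, zero_mul]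
  · have hr : (ν.map avg).rnDeriv μ y ≠ 0 := by
      intro h
      apply h0
      show ((jointLaw ν avg).fst.rnDeriv μ y).toNNReal = 0
      rw [jointLaw_fst ν havg, h, ENNReal.toNNReal_zero]
    have hfull := hy hr
    have hS : MeasurableSet {U : β | avg U = y} := measurableSet_eq_fun havg measurable_const
    have hc : condLaw ν avg y {U : β | avg U = y}ᶜ = 0 := (prob_compl_eq_zero_iff hS).2 hfull
    have hae : ∀ᵐ U ∂(condLaw ν avg y), f U = 0 := by
      have hmem : ∀ᵐ U ∂(condLaw ν avg y), U ∈ {U : β | avg U = y} := mem_ae_iff.2 hc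
      exact hmem.mono fun U hU => hf U hU
    rw [integral_congr_ae (g := fun _ => (0 : ℝ)) hae, integral_zero, mul_zero]

end FibreVanish

section FibreVanishRT

universe u

variable {G : Type u} [GaugeGroup G] [MeasurableSpace G] [HaarData G] [StandardBorelSpace G]

/-- **AC-FREE FIBRE VANISHING FOR 11a's RESTRICTED KERNEL TRANSPORT**: for a measurable restricted averaging `avg` between finite bond sets, for
product-Haar-a.e. coarse configuration `y′`, every integrand vanishing on `avg⁻¹{y′}` has `kernelRT avg f y′ = 0`. [cite: Balaban1988Convergent, (2.21) p.258 (bookkeeping)] -/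
theorem kernelRT_ae_forall_eq_zero_of_fibre {ι ι' : Type*} [Fintype ι] [Fintype ι'] [MeasurableEq (ι' → G)]
    {avg : (ι → G) → (ι' → G)} (havg : Measurable avg) :
    ∀ᵐ y' ∂(Measure.pi fun _ : ι' => (HaarData.haar : Measure G)),
      ∀ f : (ι → G) → ℝ, (∀ y, avg y = y' → f y = 0) → kernelRT avg f y' = 0 :=
  kernelTransport_ae_forall_eq_zero_of_fibre _ _ havg

end FibreVanishRT

/-! ## §2  11a at `n = 1` on an ARBITRARY new sequence: `𝐓_1(s′)` vanishes a.e. where `ζ_0(Ω₁(s′)ᶜ)` dies on the restricted fibre -/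

section TkOneAny

variable (F : T4Family) (N : ℕ) [NeZero N] (V : Type) [NormedAddCommGroup V] [InnerProductSpace ℝ V] [FiniteDimensional ℝ V]
  [MeasurableSpace V] [BorelSpace V]

variable {F N V}

/-- Restricting a finite product of Haar measures to a sub-index-set is measure preserving onto the sub-product (the other coordinates integrate
to `1`) — product Haar measure on the bond variables of a bond set. [cite: Balaban1985Averaging, (10) p.19 (bookkeeping)] -/
theorem measurePreserving_restrict_pi {ι : Type*} [Fintype ι] [DecidableEq ι] {G : Type*} [GaugeGroup G] [MeasurableSpace G] [HaarData G]
    (T : Finset ι) :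
    MeasurePreserving (fun (f : ι → G) (b : ↥T) => f b) (Measure.pi fun _ : ι => (HaarData.haar : Measure G))
      (Measure.pi fun _ : ↥T => (HaarData.haar : Measure G)) := by
  have h0 := measurePreserving_piEquivPiSubtypeProd (fun _ : ι => (HaarData.haar : Measure G)) (fun b => b ∈ T)
  have h := measurePreserving_fst.comp h0
  convert h using 2
  rfl

/-- **RESTRICTING A COARSE FIELD TO A BOND SET PUSHES `dV₁` TO PRODUCT HAAR** on that bond set (the other coordinates integrate to `1`).
[cite: Balaban1985Averaging, (10) p.19 (bookkeeping)] -/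
theorem measurePreserving_restrict_fieldMeasure {P : Params} {j : ℕ} {G : Type*} [GaugeGroup G] [MeasurableSpace G] [HaarData G]
    (T : Finset (PBond P j)) :
    MeasurePreserving (fun (V' : GaugeField P j G) (b : ↥T) => V' b) (fieldMeasure P j G)
      (Measure.pi fun _ : ↥T => (HaarData.haar : Measure G)) := by
  classical
  unfold fieldMeasure
  exact measurePreserving_restrict_pi (G := G) T

/-- The restricted averaging of record is measurable (the averaging of record after a measurable update). [cite: Balaban1988Convergent, (2.21) p.258 (bookkeeping)] -/
theorem measurable_avgRestrOfRecord (K j : ℕ) [DecidableEq (PBond (F.P K) j)] (sV : Finset (PBond (F.P K) j))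
    (sV' : Finset (PBond (F.P K) (j + 1))) :
    Measurable (avgRestrOfRecord F N K j sV sV') := by
  unfold avgRestrOfRecord
  refine measurable_pi_lambda _ fun b' => ?_
  exact (measurable_pi_apply (b' : PBond (F.P K) (j + 1))).comp
    ((avOfRecord_measurable F N K j).comp measurable_updateFinset)

/-- **ONE BRANCH `𝐓^{(0)}(s′, S)` VANISHES a.e. WHERE ITS WEIGHT DIES ON THE RESTRICTED FIBRE** (11a's generation `0` of record on ANY new sequence `s′` and
branch `S`, any weights, any operand, read at the base configuration of `V₁`): if for every `V₁ ∈ Ro` and every configuration `y` of the V-bond variables whose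
restricted average of record is `V₁|_{sV′}` the weight `ζ_0(Ω₁(s′)ᶜ)` vanishes at the two-scale configuration `(1 updated by y, V₁)`, then
`(𝐓^{(0)}Φ)(base V₁) = 0` for `dV₁`-a.e. `V₁ ∈ Ro` — the branch is the restricted kernel transport (2.21) of `ζ·(A-factor)`, killed by §1.
[cite: Balaban1988Convergent, (2.20)–(2.22) p.258] -/
theorem genOp_zero_ae_zero_of_zeta_fibre (ν : Stage7Numerics) (M : ℕ) (g : ℕ → ℝ) (K : ℕ) {hdec : DecidableEq (PBond (F.P K) 0)}
    (W : TkWeights F N V K) (s : SeqOfRecord F ν M g K 1) (S : ℕ → Set (Site (F.P K) 0)) (Φ' : MultiCfg (F.P K) (SU N) V → ℝ)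
    {Ro : GaugeField (F.P K) 1 (SU N) → Prop}
    (hvan : ∀ V1, Ro V1 → ∀ y : ↥(genDataOfRecord F N V ν M g K W s S 0).sV → SU N,
      (∀ b : ↥(genDataOfRecord F N V ν M g K W s S 0).sV',
        avgRestrOfRecord F N K 0 (genDataOfRecord F N V ν M g K W s S 0).sV (genDataOfRecord F N V ν M g K W s S 0).sV' y b = V1 b) →
        (genDataOfRecord F N V ν M g K W s S 0).ζ
          (pairCfg V1 (Function.updateFinset (fun _ => 1) (genDataOfRecord F N V ν M g K W s S 0).sV y)) = 0) :
    ∀ᵐ V1 ∂fieldMeasure (F.P K) 1 (SU N), Ro V1 → genOp 0 (genDataOfRecord F N V ν M g K W s S 0) Φ' (baseCfg 1 V1) = 0 := by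
  have hr := measurePreserving_restrict_fieldMeasure (P := F.P K) (j := 1) (G := SU N) (genDataOfRecord F N V ν M g K W s S 0).sV'
  have hgood := kernelRT_ae_forall_eq_zero_of_fibre (G := SU N)
    (measurable_avgRestrOfRecord (F := F) (N := N) K 0 (genDataOfRecord F N V ν M g K W s S 0).sV
      (genDataOfRecord F N V ν M g K W s S 0).sV')
  rw [← hr.map_eq] at hgood
  have hgood' := ae_of_ae_map hr.measurable.aemeasurable hgood
  filter_upwards [hgood'] with V1 hV1 hRo
  rw [genOp_apply, vOp_apply]
  have hb : (fun b : ↥(genDataOfRecord F N V ν M g K W s S 0).sV' => ((baseCfg (V := V) 1 V1) (0 + 1)).1 b) =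
      fun b : ↥(genDataOfRecord F N V ν M g K W s S 0).sV' => V1 b :=
    funext fun b => baseCfg_fst_self (V := V) 1 V1 b
  rw [hb]
  refine hV1 _ fun y hy => ?_
  rw [zetaOp_apply, update_baseCfg_one_eq_pairCfg, hvan V1 hRo y (fun b => congr_fun hy b), zero_mul]

open Classical in
/-- **`𝐓_1(s′)` VANISHES a.e. WHERE ITS GENERATION-0 WEIGHT DIES ON THE RESTRICTED FIBRE** (11a at `n = 1`, ANY new sequence `s′`, any weights, any operand):
if for every `V₁ ∈ Ro` and every configuration `y` of the V-bond variables (the fine bonds in `Ω₁(s′)ᶜ`) whose restricted average of record is `V₁` on the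
image bonds the weight `W.ζ 0 (Ω₁(s′))ᶜ` vanishes at the two-scale configuration `(1 updated by y, V₁)`, then `(𝐓_1(s′)Φ)(V₁) = 0` for `dV₁`-a.e. `V₁ ∈ Ro`
(every `{S_j}`-branch is one generation, (3.24)). [cite: Balaban1988Convergent, (2.18) p.257, (2.20)–(2.22) p.258, (3.24) p.270] -/
theorem TkOfRecord_one_ae_zero_of_zeta_fibre (ν : Stage7Numerics) (M : ℕ) (g : ℕ → ℝ) (K : ℕ) (W : TkWeights F N V K)
    (s : SeqOfRecord F ν M g K 1) (Φ : SFluct (F.P K) V → B15DeterminingSets.MSField (F.P K) (SU N) → ℝ)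
    {Ro : GaugeField (F.P K) 1 (SU N) → Prop}
    (hvan : ∀ V1, Ro V1 → ∀ y : ↥(Set.toFinite (bondsIn 0 (s.Ω 1)ᶜ)).toFinset → SU N,
      (∀ b : ↥(Set.toFinite (bondsIn 1 (s.Ω 1)ᶜ)).toFinset, avgRestrOfRecord F N K 0 (Set.toFinite (bondsIn 0 (s.Ω 1)ᶜ)).toFinset (Set.toFinite (bondsIn 1 (s.Ω 1)ᶜ)).toFinset y b = V1 b) →
        W.ζ 0 (s.Ω 1)ᶜ (pairCfg V1 (Function.updateFinset (fun _ => 1) (Set.toFinite (bondsIn 0 (s.Ω 1)ᶜ)).toFinset y)) = 0) :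
    ∀ᵐ V1 ∂fieldMeasure (F.P K) 1 (SU N), Ro V1 → TkOfRecord F N V ν M g K W 1 s Φ V1 = 0 := by
  have hall : ∀ S ∈ admSOfRecord F ν M g K 1 s, ∀ᵐ V1 ∂fieldMeasure (F.P K) 1 (SU N), Ro V1 →
      genOp 0 (genDataOfRecord F N V ν M g K W s S 0) (fun ω => Φ (S, fun j => (ω j).2) (fun j => (ω j).1)) (baseCfg 1 V1) = 0 :=
    fun S _ => genOp_zero_ae_zero_of_zeta_fibre (V := V) ν M g K W s S _ hvan
  rw [← Filter.eventually_all_finset] at hall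
  filter_upwards [hall] with V1 hV1 hRo
  rw [TkOfRecord_apply]
  refine Finset.sum_eq_zero fun S hS => ?_
  rw [tkBranchOfRecord_succ, tkBranchOfRecord_zero]
  have h := hV1 S hS hRo
  convert h using 4

end TkOneAny

section TkOneRecordWeights

variable {F : T4Family} {N : ℕ} [NeZero N] {V : Type} [NormedAddCommGroup V] [InnerProductSpace ℝ V] [FiniteDimensional ℝ V]
  [MeasurableSpace V] [BorelSpace V]

open Classical in
/-- **AT 12a's 𝐓-WEIGHTS** (`ζ_0(Y) = ζ0_0(Y)·χreg_0(Y)`, `Y = Ω₁(s′)ᶜ`): `(𝐓_1(s′)Φ)(V₁) = 0` for `dV₁`-a.e. `V₁ ∈ Ro` as soon as NO configuration of the fine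
variables on `Y` with restricted average `V₁|_Y` is `cR·ε₀`-regular on the plaquettes touching `Y` — p. 256's regularity function vanishes on the whole restricted
fibre (any residual `Zt`, any operand, ANY new sequence). [cite: Balaban1988Convergent, (2.10) p.256, (2.21) p.258, (2.18) p.257] -/
theorem TkOfRecord_one_ae_zero_of_not_regular_fibre (ν : Stage7Numerics) (M : ℕ) (A₁ cR : ℝ) (p : B12.RunParams) (g : ℕ → ℝ)
    (Z : TkResidualW F N V p.K) (s : SeqOfRecord F ν M g p.K 1)
    (Φ : SFluct (F.P p.K) V → B15DeterminingSets.MSField (F.P p.K) (SU N) → ℝ) {Ro : GaugeField (F.P p.K) 1 (SU N) → Prop}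
    (hvan : ∀ V1, Ro V1 → ∀ y : ↥(Set.toFinite (bondsIn 0 (s.Ω 1)ᶜ)).toFinset → SU N,
      (∀ b : ↥(Set.toFinite (bondsIn 1 (s.Ω 1)ᶜ)).toFinset, avgRestrOfRecord F N p.K 0 (Set.toFinite (bondsIn 0 (s.Ω 1)ᶜ)).toFinset (Set.toFinite (bondsIn 1 (s.Ω 1)ᶜ)).toFinset y b = V1 b) →
        ¬ PlaqSmallOn (B8Eq17ClassAkV1.plaqsOf (B15DeterminingSets.pts 0 (s.Ω 1)ᶜ)) (cR * epsOfRecord ν g 0)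
          (Function.updateFinset (fun _ => 1) (Set.toFinite (bondsIn 0 (s.Ω 1)ᶜ)).toFinset y)) :
    ∀ᵐ V1 ∂fieldMeasure (F.P p.K) 1 (SU N), Ro V1 →
      TkOfRecord F N V ν M g p.K (tkWeightsOfRecord F N V ν A₁ cR p g Z) 1 s Φ V1 = 0 := by
  refine TkOfRecord_one_ae_zero_of_zeta_fibre (V := V) ν M g p.K _ s Φ fun V1 hRo y hy => ?_
  rw [zeta_tkWeightsOfRecord_apply, chiRegW_zero_pairCfg, if_neg (hvan V1 hRo y hy), mul_zero]

end TkOneRecordWeights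

/-! ## §3  def-T's index map: the χ-cubes of `P_{k+1}` and of `Q_{k+1}` lie OUTSIDE `Ω_{k+1}(t)` (inside the new generation's integration region) -/

section LabelGeometry

variable (P : Params) (s : ℕ)

/-- Every set lies in its cube hull: `X ⊆ X̃^{∼n}` (the `s`-cubes cover the torus, `0 < s`). [cite: Balaban1988Convergent, p.264–265 (bookkeeping)] -/
theorem subset_hullD_self (hs : 0 < s) (n : ℕ) (X : Set (Site P 0)) : X ⊆ hullD P s n X := fun x hx =>
  mem_hullD_iff.2 ⟨cubeOfSite s x, cubeOfSite_mem_cubeIndices s hs x,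
    ⟨x, cubeEnl_mono P s _ (Nat.zero_le n) (mem_cubeEnl_cubeOfSite s hs x), hx⟩, mem_cubeEnl_cubeOfSite s hs x⟩

variable (F : T4Family) (ν : Stage7Numerics) (M : ℕ) (p : B12.RunParams) (g : ℕ → ℝ) (k : ℕ)

/-- A χ-cube of a family lies in the family's point set. [cite: Balaban1988Convergent, (3.2) p.265 (bookkeeping)] -/
theorem cubeχ_subset_cubesχ {X : Finset (Iχ F ν p g k)} {c : Iχ F ν p g k} (hc : c ∈ X) : cubeχ F ν p g k c ⊆ cubesχ F ν p g k X := by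
  intro x hx
  simp only [cubesχ, Set.mem_iUnion]
  exact ⟨c, hc, hx⟩

/-- `Ω_{k+1}(t) ⊆ Ω⁰_{k+1}(P, Q)` (the guard and the filling only shrink (3.5)). [cite: Balaban1988Convergent, (3.5) p.265 (bookkeeping)] -/
theorem OmegaOfLabel_subset_Omega0 (s : SeqOfRecord F ν M g p.K k) (t : LbOfRecord F ν p g k) :
    OmegaOfLabel F ν M p g k s t ⊆ Omega0 F ν M p g k s t.1 t.2.1 :=
  (fillD_subset _ _ _).trans Set.inter_subset_left

/-- **THE χ-CUBES OF `P_{k+1}` LIE OUTSIDE `Ω_{k+1}(t)`** (`0 <` the 𝐃-side): `□′ ⊆ ∪P ⊆ P̃ ⊆ (P̃ ∪ Z̃^{∼4})^{∼1} = B^{k+1}(P¹)ᶜ ⊆ ((Bᶜ)^∼ ∪ Q̃)^{∼2} = (Ω⁰_{k+1})ᶜ`.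
[cite: Balaban1988Convergent, (3.2)–(3.5) p.265] -/
theorem cubeχ_subset_compl_OmegaOfLabel_of_mem_fst (hD : 0 < sideD F ν M p g k) (s : SeqOfRecord F ν M g p.K k)
    (t : LbOfRecord F ν p g k) {c : Iχ F ν p g k} (hc : c ∈ t.1) :
    cubeχ F ν p g k c ⊆ (OmegaOfLabel F ν M p g k s t)ᶜ := by
  intro x hx hΩ
  have h0 := OmegaOfLabel_subset_Omega0 F ν M p g k s t hΩ
  simp only [Omega0, Set.mem_compl_iff] at h0
  apply h0
  refine subset_hullD_self (F.P p.K) _ hD 2 _ (Or.inr ?_)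
  refine subset_hullD_self (F.P p.K) _ hD 0 _ ?_
  simp only [Bdom, compl_compl]
  exact subset_hullD_self (F.P p.K) _ hD 1 _ (Or.inl (subset_hullD_self (F.P p.K) _ hD 0 _ (cubeχ_subset_cubesχ F ν p g k hc hx)))

/-- **THE χ-CUBES OF `Q_{k+1}` LIE OUTSIDE `Ω_{k+1}(t)`** (`0 <` the 𝐃-side): `□′ ⊆ ∪Q ⊆ Q̃ ⊆ (Q̃ ∪ (Bᶜ)^∼)^{∼2} = (Ω⁰_{k+1})ᶜ`.
[cite: Balaban1988Convergent, (3.3)–(3.5) p.265] -/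
theorem cubeχ_subset_compl_OmegaOfLabel_of_mem_snd (hD : 0 < sideD F ν M p g k) (s : SeqOfRecord F ν M g p.K k)
    (t : LbOfRecord F ν p g k) {c : Iχ F ν p g k} (hc : c ∈ t.2.1) :
    cubeχ F ν p g k c ⊆ (OmegaOfLabel F ν M p g k s t)ᶜ := by
  intro x hx hΩ
  have h0 := OmegaOfLabel_subset_Omega0 F ν M p g k s t hΩ
  simp only [Omega0, Set.mem_compl_iff] at h0
  apply h0
  refine subset_hullD_self (F.P p.K) _ hD 2 _ (Or.inl ?_)
  exact subset_hullD_self (F.P p.K) _ hD 0 _ (cubeχ_subset_cubesχ F ν p g k hc hx)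

/-- Hence for a label with `(P_{k+1}, Q_{k+1}) ≠ (∅, ∅)` some χ-cube lies outside `Ω_{k+1}(t)`. [cite: Balaban1988Convergent, (3.2)–(3.5) p.265] -/
theorem exists_cubeχ_subset_compl_OmegaOfLabel (hD : 0 < sideD F ν M p g k) (s : SeqOfRecord F ν M g p.K k)
    (t : LbOfRecord F ν p g k) (ht : t.1 ≠ ∅ ∨ t.2.1 ≠ ∅) :
    ∃ c : Iχ F ν p g k, cubeχ F ν p g k c ⊆ (OmegaOfLabel F ν M p g k s t)ᶜ := by
  rcases ht with h | h
  · obtain ⟨c, hc⟩ := Finset.nonempty_iff_ne_empty.2 h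
    exact ⟨c, cubeχ_subset_compl_OmegaOfLabel_of_mem_fst F ν M p g k hD s t hc⟩
  · obtain ⟨c, hc⟩ := Finset.nonempty_iff_ne_empty.2 h
    exact ⟨c, cubeχ_subset_compl_OmegaOfLabel_of_mem_snd F ν M p g k hD s t hc⟩

end LabelGeometry

/-! ## §4  def-T's weights at the first step: the `(∅, ∅)` label charges only globally small fine fields -/

section EmptyLabel

variable (F : T4Family) (N : ℕ) [NeZero N] (ν : Stage7Numerics) (M : ℕ) (A₁ : ℝ) (p : B12.RunParams) (g : ℕ → ℝ) (k : ℕ)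

/-- The (3.2) factor is `0` or `1`. [cite: Balaban1988Convergent, (3.2) p.265 (bookkeeping)] -/
theorem chiFactor_eq_zero_or_one (c : Iχ F ν p g k) (V' : GaugeField (F.P p.K) (k + 1) (SU N)) :
    chiFactor F N ν p g k c V' = 0 ∨ chiFactor F N ν p g k c V' = 1 := by
  unfold chiFactor chiSmall
  split_ifs
  · exact Or.inr rfl
  · exact Or.inl rfl

variable (s₀ : SeqOfRecord F ν M g p.K 0)

/-- **`a(∅)(V₁) ≠ 0` ⇒ EVERY χ₁-cube is (3.2)-SMALL at `V₁`** (first step: the (3.2) range is all cubes; `a(∅) = Π_□′ χ_□′`).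
[cite: Balaban1988Convergent, (3.2) p.265] -/
theorem forall_chiFactor_eq_one_of_aWeight_empty_ne_zero (V' : GaugeField (F.P p.K) 1 (SU N))
    (ha : aWeight F N ν M p g 0 s₀ ∅ V' ≠ 0) (c : Iχ F ν p g 0) : chiFactor F N ν p g 0 c V' = 1 := by
  classical
  rcases chiFactor_eq_zero_or_one F N ν p g 0 c V' with h0 | h1
  · exfalso
    apply ha
    rw [aWeight, if_pos (Finset.empty_subset _), chiNext_sect3DataOfRecord, Finset.sdiff_empty, cubes32_zero]
    rw [Finset.prod_eq_zero (Finset.mem_univ c) h0, zero_mul]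
  · exact h1

/-- **`b(∅, ∅)(U, V₁) ≠ 0` ⇒ EVERY χ₁-cube is (3.3)-SMALL at `(U, V₁)`** (first step: the (3.3) range of `P = ∅` is all cubes; `b(∅,∅) = Π_□′ χ′_□′`).
[cite: Balaban1988Convergent, (3.3) p.265] -/
theorem forall_smallApproxFluct_of_bWeight_empty_ne_zero (U : GaugeField (F.P p.K) 0 (SU N)) (V' : GaugeField (F.P p.K) 1 (SU N))
    (hb : bWeight F N ν M p g 0 A₁ s₀ ∅ ∅ U V' ≠ 0) (c : Iχ F ν p g 0) :
    SmallApproxFluct (sect3DataOfRecord F N ν M p g 0 s₀) (avOfRecord F N p.K) (2 * deltaOfRecord ν g 0 A₁) U V' c := by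
  classical
  by_contra hc
  apply hb
  rw [bWeight, if_pos (Finset.empty_subset _), Finset.sdiff_empty, qcubes_zero_empty]
  unfold chiPrime
  show (∏ c' ∈ (Finset.univ : Finset (Iχ F ν p g 0)),
      (if SmallApproxFluct (sect3DataOfRecord F N ν M p g 0 s₀) (avOfRecord F N p.K) (2 * deltaOfRecord ν g 0 A₁) U V' c'
        then (1 : ℝ) else 0)) * _ = 0
  rw [Finset.prod_eq_zero (Finset.mem_univ c) (if_neg hc), zero_mul]

/-- **ALL CUBES (3.2)-SMALL AND (3.3)-SMALL ⇒ THE OLD FIELD IS GLOBALLY `(ε₁η₁² + 4·(2δ₀))`-PLAQUETTE-SMALL** (either (2.12) branch: g5's per-cube lemma on the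
cube of each plaquette's source, `0 <` the χ-side). [cite: Balaban1988Convergent, (3.2)–(3.4) p.265, (2.16)–(2.17) p.257] -/
theorem plaqSmall_of_forall_chiFactor_eq_one_of_forall_smallApproxFluct (hχ : 0 < sideχ F ν p g 0) (U : GaugeField (F.P p.K) 0 (SU N))
    (V' : GaugeField (F.P p.K) 1 (SU N)) (hflat : ∀ c : Iχ F ν p g 0, chiFactor F N ν p g 0 c V' = 1)
    (hsmall : ∀ c : Iχ F ν p g 0, SmallApproxFluct (sect3DataOfRecord F N ν M p g 0 s₀) (avOfRecord F N p.K) (2 * deltaOfRecord ν g 0 A₁) U V' c) :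
    PlaqSmall (epsOfRecord ν g 1 * (F.P p.K).eta 1 ^ 2 + 4 * (2 * deltaOfRecord ν g 0 A₁)) U := by
  intro q
  by_contra hq
  push Not at hq
  set c : Iχ F ν p g 0 := ⟨cubeOfSite (sideχ F ν p g 0) q.src, cubeOfSite_mem_cubeIndices _ hχ q.src⟩ with hc
  have hmem : q ∈ plaqInside (cubeEnl (F.P p.K) (sideχ F ν p g 0) c 1) := plaq_mem_plaqInside_cubeEnl_src _ hχ q
  exact not_smallApproxFluct_zero_of_chiFactor_eq_one_of_rough F N ν M A₁ p g s₀ c U V' (hflat c) hmem hq (hsmall c)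

/-- **THE `(∅, ∅)` LABEL CHARGES ONLY GLOBALLY SMALL OLD FIELDS**: if `a(∅)(V₁)·b(∅,∅)(U,V₁) ≠ 0` then `U` is `(ε₁η₁² + 4·(2δ₀))`-plaquette-small on the whole torus.
[cite: Balaban1988Convergent, (3.2)–(3.5) p.265] -/
theorem plaqSmall_of_aWeight_mul_bWeight_empty_ne_zero (hχ : 0 < sideχ F ν p g 0) (U : GaugeField (F.P p.K) 0 (SU N))
    (V' : GaugeField (F.P p.K) 1 (SU N)) (h : aWeight F N ν M p g 0 s₀ ∅ V' * bWeight F N ν M p g 0 A₁ s₀ ∅ ∅ U V' ≠ 0) :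
    PlaqSmall (epsOfRecord ν g 1 * (F.P p.K).eta 1 ^ 2 + 4 * (2 * deltaOfRecord ν g 0 A₁)) U :=
  plaqSmall_of_forall_chiFactor_eq_one_of_forall_smallApproxFluct F N ν M A₁ p g s₀ hχ U V'
    (forall_chiFactor_eq_one_of_aWeight_empty_ne_zero F N ν M p g s₀ V' (left_ne_zero_of_mul h))
    (forall_smallApproxFluct_of_bWeight_empty_ne_zero F N ν M A₁ p g s₀ U V' (right_ne_zero_of_mul h))

open Classical in
/-- **A NEW SEQUENCE REACHED ONLY BY `(∅, ∅)`-LABELS WEIGHS `0` WHERE `a(∅)·b(∅,∅)` DOES** (any `k`, any `ζ`): if every label mapped to `s′` has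
`(P_{k+1}, Q_{k+1}) = (∅, ∅)` and `a(∅)(V′)·b(∅,∅)(U,V′) = 0`, then `w(s′)(U, V′) = 0`. [cite: Balaban1988Convergent, (3.5) p.265, §3 p.267] -/
theorem wOfRecord_eq_zero_of_forall_label_empty (ζ : ZetaOfRecord F N ν M) (s' : SeqOfRecord F ν M g p.K (k + 1))
    (hlab : ∀ t : LbOfRecord F ν p g k, σOfRecord F ν M p g k s'.init t = s' → t.1 = ∅ ∧ t.2.1 = ∅)
    (U : GaugeField (F.P p.K) k (SU N)) (V' : GaugeField (F.P p.K) (k + 1) (SU N))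
    (hab : aWeight F N ν M p g k s'.init ∅ V' * bWeight F N ν M p g k A₁ s'.init ∅ ∅ U V' = 0) :
    wOfRecord F N ν M A₁ ζ p g k s' U V' = 0 := by
  rw [wOfRecord_apply, resumWeights]
  refine Finset.sum_eq_zero fun t ht => ?_
  obtain ⟨h1, h2⟩ := hlab t (Finset.mem_filter.1 ht).2
  rw [ωOfRecord, h1, h2, hab, zero_mul]

end EmptyLabel

/-! ## §5  Torus geometry: the central coarse plaquette of a cube and the label ball around it -/

section Central

open B14DomainGeom B14.Eq213MaximalDomains B15Eq112TorusCover B15LatticeCubeTorus B15DeterminingSets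

variable {P : Params} {S : ℕ} {a : Pt P.d}

/-- **THE LABEL BALL OF RADIUS `R` AROUND THE CENTRAL COARSE SITE LIES IN THE CUBE** (`2·(R + L + 1) ≤ S`, standing range `1 ≤ m + K`): every fine site whose
coordinates differ from those of `emb (centralSite)` by residues of integers of size `≤ R` belongs to `cubeEnl P S a 0`.  (The centre's block label is within `L`
of the centre; no divisibility of the site count by `S` is used.) [cite: Balaban1987RG1, (0.1)–(0.3) pp.251–252; Balaban1988Convergent, (2.17) p.257] -/
theorem mem_cubeEnl_of_near_emb_centralSite (hmK : 1 ≤ P.m + P.K) {R : ℕ} (hS : 2 * (R + P.L + 1) ≤ S) {z : Site P 0}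
    (hz : ∀ i, ∃ e : ℤ, |e| ≤ (R : ℤ) ∧ z i = emb (blockOf (cover P (fun i => (S : ℤ) * a i + ((S / 2 : ℕ) : ℤ)))) i + (e : ZMod (P.sitesPerDir 0))) :
    z ∈ cubeEnl P S a 0 := by
  choose e he using hz
  have hmK' : 0 + 1 ≤ P.m + P.K := hmK
  have hnear : ∀ i, |(((emb (blockOf (cover P (fun i => (S : ℤ) * a i + ((S / 2 : ℕ) : ℤ))))) i).val : ℤ) - (((cover P (fun i => (S : ℤ) * a i + ((S / 2 : ℕ) : ℤ))) i).val : ℤ)| ≤ P.L := fun i =>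
    abs_val_emb_blockOf_sub_le hmK' (cover P (fun i => (S : ℤ) * a i + ((S / 2 : ℕ) : ℤ))) i
  -- name the half side so that casts do not touch the division
  obtain ⟨h, hh⟩ : ∃ h : ℕ, S / 2 = h := ⟨_, rfl⟩
  have hdiv : 2 * h ≤ S := hh ▸ Nat.mul_div_le S 2
  have hdiv' : R + P.L + 1 ≤ h := by rw [← hh]; omega
  have hc : ∀ i, cover P (fun i => (S : ℤ) * a i + ((S / 2 : ℕ) : ℤ)) i = (((S : ℤ) * a i + (h : ℤ) : ℤ) : ZMod (P.sitesPerDir 0)) := fun i => by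
    rw [cover_apply, hh]
  -- the integer witness
  refine ⟨fun i => (S : ℤ) * a i + (h : ℤ) +
      ((((emb (blockOf (cover P (fun i => (S : ℤ) * a i + ((S / 2 : ℕ) : ℤ))))) i).val : ℤ) - (((cover P (fun i => (S : ℤ) * a i + ((S / 2 : ℕ) : ℤ))) i).val : ℤ)) + e i, fun i => ?_, ?_⟩
  · have h1 := abs_le.1 (hnear i)
    have h2 := abs_le.1 (he i).1
    have hdivZ : ((R : ℤ) + P.L + 1) ≤ (h : ℤ) := by exact_mod_cast hdiv'
    have hdivZ' : 2 * (h : ℤ) ≤ (S : ℤ) := by exact_mod_cast hdiv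
    simp only [Nat.zero_mul, Nat.cast_zero, sub_zero, add_zero]
    constructor <;> linarith
  · funext i
    rw [(he i).2, cover_apply]
    have hx : ((((emb (blockOf (cover P (fun i => (S : ℤ) * a i + ((S / 2 : ℕ) : ℤ))))) i).val : ℤ) : ZMod (P.sitesPerDir 0)) = (emb (blockOf (cover P (fun i => (S : ℤ) * a i + ((S / 2 : ℕ) : ℤ))))) i := by
      rw [Int.cast_natCast, ZMod.natCast_zmod_val]
    have ht : ((((cover P (fun i => (S : ℤ) * a i + ((S / 2 : ℕ) : ℤ))) i).val : ℤ) : ZMod (P.sitesPerDir 0)) = (((S : ℤ) * a i + (h : ℤ) : ℤ) : ZMod _) := by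
      rw [Int.cast_natCast, ZMod.natCast_zmod_val, hc]
    simp only [Int.cast_add, Int.cast_sub, hx, ht]
    ring

/-- The central coarse site itself embeds into the cube (`2·(L + 1) ≤ S`). [cite: Balaban1988Convergent, (2.17) p.257 (bookkeeping)] -/
theorem emb_centralSite_mem (hmK : 1 ≤ P.m + P.K) (hS : 2 * (0 + P.L + 1) ≤ S) : emb (blockOf (cover P (fun i => (S : ℤ) * a i + ((S / 2 : ℕ) : ℤ)))) ∈ cubeEnl P S a 0 :=
  mem_cubeEnl_of_near_emb_centralSite (R := 0) hmK hS fun i => ⟨0, by simp, by simp⟩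

/-- A unit translate of the central coarse site embeds into the cube (`2·(2L + 1) ≤ S`; `emb (y + e_μ) = emb y + L e_μ`).
[cite: Balaban1987RG1, (0.1) p.251; Balaban1988Convergent, (2.17) p.257 (bookkeeping)] -/
theorem emb_shift_centralSite_mem (hmK : 1 ≤ P.m + P.K) (hS : 2 * (P.L + P.L + 1) ≤ S) (μ : Fin P.d) :
    emb ((blockOf (cover P (fun i => (S : ℤ) * a i + ((S / 2 : ℕ) : ℤ)))).shift μ) ∈ cubeEnl P S a 0 := by
  refine mem_cubeEnl_of_near_emb_centralSite (R := P.L) hmK hS fun i => ?_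
  refine ⟨if i = μ then (P.L : ℤ) else 0, ?_, ?_⟩
  · split_ifs <;> simp
  · rw [emb_shift_apply]
    split_ifs <;> simp

/-- A double unit translate of the central coarse site embeds into the cube (`2·(3L + 1) ≤ S`). [cite: Balaban1988Convergent, (2.17) p.257 (bookkeeping)] -/
theorem emb_shift_shift_centralSite_mem (hmK : 1 ≤ P.m + P.K) (hS : 2 * (2 * P.L + P.L + 1) ≤ S) (μ ν : Fin P.d) :
    emb (((blockOf (cover P (fun i => (S : ℤ) * a i + ((S / 2 : ℕ) : ℤ)))).shift μ).shift ν) ∈ cubeEnl P S a 0 := by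
  refine mem_cubeEnl_of_near_emb_centralSite (R := 2 * P.L) hmK hS fun i => ?_
  have hL : (0 : ℤ) ≤ (P.L : ℤ) := by positivity
  refine ⟨(if i = μ then (P.L : ℤ) else 0) + (if i = ν then (P.L : ℤ) else 0), ?_, ?_⟩
  · rw [abs_le]
    split_ifs <;> push_cast <;> constructor <;> linarith
  · rw [emb_shift_apply, emb_shift_apply]
    split_ifs <;> push_cast <;> ring

/-- **THE CENTRAL COARSE PLAQUETTE HAS ITS FOUR BONDS IN `bondsIn 1 □`** (`2·(3L + 1) ≤ S`): every bond of the boundary of a level-1 plaquette at the central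
site has both fine images of its endpoints in the cube. [cite: Balaban1985Variational, (3) p.278; Balaban1988Convergent, (2.21) p.258 (bookkeeping)] -/
theorem mem_bondsIn_of_corner_centralSite (hmK : 1 ≤ P.m + P.K) (hS : 2 * (2 * P.L + P.L + 1) ≤ S) {b : PBond P 1}
    (hb : b.src = blockOf (cover P (fun i => (S : ℤ) * a i + ((S / 2 : ℕ) : ℤ))) ∨ (∃ μ, b.src = (blockOf (cover P (fun i => (S : ℤ) * a i + ((S / 2 : ℕ) : ℤ)))).shift μ)) :
    b ∈ bondsIn 1 (cubeEnl P S a 0) := by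
  have hS1 : 2 * (P.L + P.L + 1) ≤ S := by omega
  have hS0 : 2 * (0 + P.L + 1) ≤ S := by omega
  rw [mem_bondsIn_iff]
  rcases hb with h | ⟨μ, h⟩
  · rw [h]
    exact ⟨emb_centralSite_mem hmK hS0, emb_shift_centralSite_mem hmK hS1 _⟩
  · rw [h]
    exact ⟨emb_shift_centralSite_mem hmK hS1 _, emb_shift_shift_centralSite_mem hmK hS _ _⟩

end Central

end Literature.MathematicalPhysics.QuantumFieldTheory.Balaban1983to89.Node00

end
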